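import Mathlib
import Literature.NumberTheory.LFunctions.Zhang2022.Section10Range1113Top
import Literature.NumberTheory.LFunctions.Zhang2022.Section10CRanges1422
import Literature.NumberTheory.LFunctions.Zhang2022.Section10Range1321MidRel
import HarnessLib

/-!
# Zhang (2022) §10 p. 57: the first lines of the two upper ranges of `Θ₁(𝐚₁₁,𝐚₁₃)`
# (`Z22:§10.u037`/`u038`, `Typed.Sec10B.Eq1037a`/`Eq1038a`) from the RELATIVE, Π-WEIGHTED Lemma 10.2

Topic `Literature/NumberTheory/LFunctions/Zhang2022` (Landau–Siegel adjudication tree;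
verdict-neutral). Y. Zhang, *Discrete mean estimates and the Landau–Siegel zero*,
arXiv:2211.02515v1 (2022) [Zhang2022LandauSiegel], §10 «Proof of Proposition 2.4», PDF p. 57
(tex L2925–L2945): "the sum over `P^{0.5} ≤ dr < P^{0.502}` is equal to `(500L′(1,χ)²/(0.504 log²P))
Σ_{P^{0.5}≤n<P^{0.502}} |χ(n)|λ₀ⱼ(n)φ(n)⁻¹ 𝔣_{j6}(P^{0.504}/n)(−1 + 𝔶₁ⱼ(n)) + o(α)`" and its twin for
`P^{0.502} ≤ dr < P^{0.504}` — **an unrefereed manuscript under adjudication; every hypothesis below is a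
CLAIM of the manuscript; nothing here bears on its Theorems 1–2 or on Landau–Siegel zeros.**
ZHANG-L discharge lane (WP10, seat zl-w10-p5, helper under the v19/v20 leaf `Typed.Sec10B.Concl1113`).

Why this file. The tree's edges `Skeleton.eq1037a_of` / `eq1038a_of` (sz-d41, `Section10Range1113`,
`Section10Range1113Top`) consume the banked ABSOLUTE Lemma 10.2 `Skeleton.Lemma102 c′`, whose clauses
the cell's record classes underivable as printed uniformly in `(d,r)` (GAP rows G-d43-1: (10.8)–(10.10)
hold only with the factor `(∏_{q∣dr}(1−q⁻¹)⁻¹)² = (dr/φ(dr))²` of Lemma 8.4ᴿ; G-d60-1: (10.11) only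
`Π(d,r)`-weighted), and the lane re-types the §10 binder accordingly (RETYPE-LEDGER RT-01′, ruling R-13).
This file re-runs the two range assemblies with those weights: the pointwise errors of the main range
AND of the `T`-windows carry `(n/φ(n))²` (`n = dr`), absorbed by the window weight sums with exponent
`7` instead of `5` (sz-L3-t4's doubly-weighted `Ranges1422.range_assembly_bound₃`; d41's
`weight_sum_exp_range 7` / `weight_sum_windows 7`); everything else — the `m`-sum by Lemma 8.2
(`Skeleton.Lemma82`, tree theorem for `c′ ≥ 0`), the (8.10) collapse (`Section8cStatements.Eq810`, tree
theorem `eq810_holds`), the main terms, the constants — is d41's verbatim. The Lemma-10.2 input is taken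
in the WEAKEST SHAPE USED, stated inline (no new definition): clauses (10.9), (10.10) relative and the
window clause (10.11) with the same `(∏_{q∣dr}(1−q⁻¹)⁻¹)²` factor; the `(1 + ‖Π(d,r)‖)`-weighted window
clause implies it with `C ↦ 2C` (`relW_window_of_PiW_window`, from `‖Π(d,r)‖ ≤ (dr/φ(dr))²`,
`Section10RangeToolkit.norm_PiW_le`; `(∏_{q∣n}(1−q⁻¹)⁻¹)² = (n/φ(n))²` is zl-w10-p4's
`Sj1321Mid.prod_one_sub_inv_inv_sq_eq`).

* `eq1037a_of_relW` — `Eq1037a c′` ⇐ (10.9)ᴿ ∧ (10.11)ᵂ, `Lemma82 c′`, `Eq810`; error `≪ 𝓛⁻¹⁰ = o(α)`.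
* `eq1038a_of_relW` — `Eq1038a c′` ⇐ (10.10)ᴿ ∧ (10.11)ᵂ, `Lemma82 c′`, `Eq810`; error `≪ 𝓛⁻¹⁰ = o(α)`.

Theorem-only; 0 new definitions, 0 facts.

## References

* Y. Zhang, arXiv:2211.02515v1 (2022), §10 p. 57 (tex L2925–2945), Lemma 10.2 p. 55, Lemma 8.2
  p. 46, (8.10) p. 48. [cite: Zhang2022LandauSiegel, §10 p.57]
-/

noncomputable section

open Complex Real Finset

namespace Literature.NumberTheory.LFunctions.Zhang2022.Skeleton

open Literature.NumberTheory.LFunctions.Zhang2022.Typed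
open Literature.NumberTheory.LFunctions.Zhang2022.Typed.Sec10C.Ranges1422 (range_assembly_bound₃)
open Literature.NumberTheory.LFunctions.Zhang2022.Section8cProofs (large_D)
open Literature.NumberTheory.LFunctions.Zhang2022.Sj1321Mid (prod_one_sub_inv_inv_sq_eq)

variable (c' : ℝ) {D : ℕ} (χ : DirichletCharacter ℂ D)

/-! ## The relative factor and the window shapes -/

/-- The `(1 + ‖Π(d,r)‖)`-weighted window bound implies the `(dr/φ(dr))²`-weighted one with twice the
constant (`‖Π(d,r)‖ ≤ (dr/φ(dr))²`, `1 ≤ (dr/φ(dr))²`). [cite: Zhang2022LandauSiegel, §10 (10.11)] -/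
theorem relW_window_of_PiW_window {C : ℝ} (hC : 0 ≤ C) {d r : ℕ} (hd : 1 ≤ d) (hr : 1 ≤ r) {x : ℝ}
    (h : x ≤ C * (1 + ‖PiW χ d r‖) * (ell D ^ 7)⁻¹) :
    x ≤ 2 * C * (ell D ^ 7)⁻¹ * (∏ q ∈ (d * r).primeFactors, (1 - (q : ℝ)⁻¹)⁻¹) ^ 2 := by
  have hn : d * r ≠ 0 := Nat.mul_ne_zero (by omega) (by omega)
  rw [prod_one_sub_inv_inv_sq_eq hn]
  have hPiW := norm_PiW_le χ (d := d) (r := r) (by omega) (by omega)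
  have h1 : (1 : ℝ) ≤ (((d * r : ℕ) : ℝ) / Nat.totient (d * r)) ^ 2 :=
    one_le_pow₀ (one_le_self_div_totient hn)
  have hℓ : 0 ≤ (ell D ^ 7)⁻¹ :=
    inv_nonneg.mpr (pow_nonneg (by rw [ell]; exact Real.log_natCast_nonneg D) 7)
  have h12 : 1 + ‖PiW χ d r‖ ≤ (((d * r : ℕ) : ℝ) / Nat.totient (d * r)) ^ 2 +
      (((d * r : ℕ) : ℝ) / Nat.totient (d * r)) ^ 2 := add_le_add h1 hPiW
  calc x ≤ C * (1 + ‖PiW χ d r‖) * (ell D ^ 7)⁻¹ := h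
    _ ≤ C * ((((d * r : ℕ) : ℝ) / Nat.totient (d * r)) ^ 2 +
          (((d * r : ℕ) : ℝ) / Nat.totient (d * r)) ^ 2) * (ell D ^ 7)⁻¹ :=
        mul_le_mul_of_nonneg_right (mul_le_mul_of_nonneg_left h12 hC) hℓ
    _ = 2 * C * (ell D ^ 7)⁻¹ * ((((d * r : ℕ) : ℝ)) / Nat.totient (d * r)) ^ 2 := by ring

/-- The final numeric step with exponent-7 weights on BOTH sides: `W₁A₁ + W₂A₂ ≤ επ𝓛⁻⁹` for
`W₁ ≤ e^{256}𝓛⁹`, `A₁ ≤ K₁𝓛⁻²²`, `W₂ ≤ 2e^{256}𝓛²`, `A₂ ≤ K₂𝓛⁻¹²`, once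
`𝓛 ≥ (e^{256}K₁ + 2e^{256}K₂)/(επ)`. [cite: Zhang2022LandauSiegel, §10 p. 57] -/
theorem final_bound_rel {L ε K₁ K₂ W₁ W₂ A₁ A₂ : ℝ} (hL1 : 1 ≤ L) (hε : 0 < ε) (hK₁ : 0 ≤ K₁)
    (hK₂ : 0 ≤ K₂) (hA₁0 : 0 ≤ A₁) (hA₂0 : 0 ≤ A₂)
    (hW₁ : W₁ ≤ Real.exp 256 * L ^ 9) (hW₂ : W₂ ≤ 2 * Real.exp 256 * L ^ 2)
    (hA₁ : A₁ ≤ K₁ * (L ^ 22)⁻¹) (hA₂ : A₂ ≤ K₂ * (L ^ 12)⁻¹)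
    (hLX : (Real.exp 256 * K₁ + 2 * Real.exp 256 * K₂) / (ε * π) ≤ L) :
    W₁ * A₁ + W₂ * A₂ ≤ ε * (π / L ^ 9) := by
  have hL0 : 0 < L := by linarith
  set K : ℝ := Real.exp 256 * K₁ + 2 * Real.exp 256 * K₂ with hK
  have hK0 : 0 ≤ K := by positivity
  have step1 : W₁ * A₁ + W₂ * A₂ ≤
      (Real.exp 256 * L ^ 9) * (K₁ * (L ^ 22)⁻¹) +
        (2 * Real.exp 256 * L ^ 2) * (K₂ * (L ^ 12)⁻¹) := by
    gcongr
  have e1 : Real.exp 256 * L ^ 9 * (K₁ * (L ^ 22)⁻¹) = Real.exp 256 * K₁ * (L ^ 13)⁻¹ := by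
    field_simp
  have e2 : 2 * Real.exp 256 * L ^ 2 * (K₂ * (L ^ 12)⁻¹) =
      2 * Real.exp 256 * K₂ * (L ^ 10)⁻¹ := by
    field_simp
  have h1310 : (L ^ 13)⁻¹ ≤ (L ^ 10)⁻¹ := by
    rw [inv_le_inv₀ (by positivity) (by positivity)]
    exact pow_le_pow_right₀ hL1 (by norm_num)
  have step2 : Real.exp 256 * K₁ * (L ^ 13)⁻¹ + 2 * Real.exp 256 * K₂ * (L ^ 10)⁻¹ ≤
      K * (L ^ 10)⁻¹ := by
    rw [hK, add_mul]
    have : Real.exp 256 * K₁ * (L ^ 13)⁻¹ ≤ Real.exp 256 * K₁ * (L ^ 10)⁻¹ :=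
      mul_le_mul_of_nonneg_left h1310 (by positivity)
    linarith
  have hKle' : K ≤ ε * π * L := by
    have := hLX
    rwa [div_le_iff₀ (by positivity), mul_comm] at this
  have step3 : K * (L ^ 10)⁻¹ ≤ ε * (π / L ^ 9) := by
    rw [show ε * (π / L ^ 9) = (ε * π * L) * (L ^ 10)⁻¹ by field_simp]
    gcongr
  calc W₁ * A₁ + W₂ * A₂ ≤ _ := step1
    _ = Real.exp 256 * K₁ * (L ^ 13)⁻¹ + 2 * Real.exp 256 * K₂ * (L ^ 10)⁻¹ := by rw [e1, e2]
    _ ≤ K * (L ^ 10)⁻¹ := step2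
    _ ≤ ε * (π / L ^ 9) := step3

/-- Weights: `‖a(n)‖(n/φ(n))^k ≤ (n/φ(n))^{k+4}/n` for `a(n) = |χ(n)|λ₀ⱼ(n)/n` (`|λ₀ⱼ(n)| ≤ (n/φ(n))⁴`).
[cite: Zhang2022LandauSiegel, §8 p. 48] -/
theorem norm_weight_pow_le (j : ℕ) {n : ℕ} (hn : n ≠ 0) (k : ℕ) :
    ‖(‖χ (n : ZMod D)‖ : ℂ) * lamZero c' D j n / (n : ℂ)‖ * ((n : ℝ) / Nat.totient n) ^ k ≤
      ((n : ℝ) / Nat.totient n) ^ (k + 4) / n := by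
  have hχ : ‖χ (n : ZMod D)‖ ≤ 1 := DirichletCharacter.norm_le_one χ _
  have hlam := norm_lamZero_le c' D j hn
  have hr1 := one_le_self_div_totient hn
  rw [norm_div, norm_mul, Complex.norm_real, Real.norm_eq_abs, abs_norm, Complex.norm_natCast]
  calc ‖χ (n : ZMod D)‖ * ‖lamZero c' D j n‖ / n * ((n : ℝ) / Nat.totient n) ^ k
      ≤ 1 * ((n : ℝ) / Nat.totient n) ^ 4 / n * ((n : ℝ) / Nat.totient n) ^ k := by gcongr
    _ = ((n : ℝ) / Nat.totient n) ^ (k + 4) / n := by ring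

set_option maxHeartbeats 400000 in
-- one long assembly proof (main range + two windows, two factor estimates); twice the default budget
/-- **`Z22:§10.u037` (first line) from the relative, Π-weighted Lemma 10.2**: `Typed.Sec10B.Eq1037a c′`
— "the sum over `P^{0.5} ≤ dr < P^{0.502}` [of `Sⱼ(𝐚₁₁,𝐚₁₃)`] is equal to `(500L′(1,χ)²/(0.504 log²P))
Σ_{P^{0.5}≤n<P^{0.502}} |χ(n)|λ₀ⱼ(n)φ(n)⁻¹𝔣_{j6}(P^{0.504}/n)(−1 + 𝔶₁ⱼ(n)) + o(α)`" (§10 p. 57, tex L2932)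
— FOLLOWS (kernel-checked) from: (10.9) in the RELATIVE form (error `C𝓛⁻¹⁵(∏_{q∣dr}(1−q⁻¹)⁻¹)²`) together
with the `T`-window bound (10.11) in the same weighted form (first argument, stated inline — the shape
of the lane's re-typed §10 binder RT-01′), Lemma 8.2 (`Skeleton.Lemma82 c′`, a tree theorem for
`c′ ≥ 0`) and (8.10) (`Section8cStatements.Eq810`, tree theorem `eq810_holds`); the error is
`≪ 𝓛⁹·𝓛⁻²² + 𝓛²·𝓛⁻¹⁴ = o(𝓛⁻⁹) = o(α)` with the exponent-7 weight sums. Port of sz-d41's `eq1037a_of`.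
[cite: Zhang2022LandauSiegel, §10 p. 57] -/
theorem eq1037a_of_relW [NeZero D]
    (h102 : ∃ C : ℝ, ForAllLarge fun D _ χ => AssumptionA D χ →
      ∀ j ∈ ({1, 2, 3} : Finset ℕ), ∀ d r : ℕ, 1 ≤ d → 1 ≤ r →
        (bigP D ^ (0.5 : ℝ) < ((d * r : ℕ) : ℝ) → ((d * r : ℕ) : ℝ) ≤ bigP D ^ (0.502 : ℝ) / bigT D →
          ‖frakv2 c' χ j d r - 500 * deriv χ.LFunction 1 * PiW χ d r / Real.log (bigP D) *
            (-1 + fraky1 c' D j ((d * r : ℕ) : ℝ))‖ ≤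
              C * (ell D ^ 15)⁻¹ * (∏ q ∈ (d * r).primeFactors, (1 - (q : ℝ)⁻¹)⁻¹) ^ 2) ∧
        ((bigP D ^ (0.5 : ℝ) / bigT D < ((d * r : ℕ) : ℝ) ∧ ((d * r : ℕ) : ℝ) ≤ bigP D ^ (0.5 : ℝ)) ∨
            (bigP D ^ (0.502 : ℝ) / bigT D < ((d * r : ℕ) : ℝ) ∧
              ((d * r : ℕ) : ℝ) ≤ bigP D ^ (0.502 : ℝ)) ∨
            (bigP D ^ (0.504 : ℝ) / bigT D < ((d * r : ℕ) : ℝ) ∧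
              ((d * r : ℕ) : ℝ) < bigP D ^ (0.504 : ℝ)) →
          ‖frakv2 c' χ j d r‖ ≤
            C * (ell D ^ 7)⁻¹ * (∏ q ∈ (d * r).primeFactors, (1 - (q : ℝ)⁻¹)⁻¹) ^ 2))
    (h82 : Lemma82 c') (h810 : Section8cStatements.Eq810) : Sec10B.Eq1037a c' := by
  classical
  intro ε hε
  obtain ⟨C₁, H₁⟩ := h102
  obtain ⟨C₂, H₂⟩ := h82
  -- the final constants (d41's, with the window constant read at exponent 12)
  set K₁ : ℝ := (254 * Real.exp (9 / 2) + 2 * |C₂|) * |C₁| + 8000 * Real.exp (9 / 2) * |C₂|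
    with hK₁
  set K₂ : ℝ := (254 * Real.exp (9 / 2) + 2 * |C₂|) * |C₁| +
    1016000 * (Real.exp (9 / 2) * Real.exp (9 / 2)) with hK₂
  have hK₁0 : 0 ≤ K₁ := by positivity
  have hK₂0 : 0 ≤ K₂ := by positivity
  set X : ℝ := (Real.exp 256 * K₁ + 2 * Real.exp 256 * K₂) / (ε * π) + 5 with hX
  obtain ⟨D₀, hH⟩ := H₁.and H₂
  refine ⟨max D₀ (max ⌈Real.exp (π * |c'| + 5)⌉₊ ⌈Real.exp X⌉₊), fun D _ χ hD hq hp hA j hj => ?_⟩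
  have hD₀ : D₀ ≤ D := le_trans (le_max_left _ _) hD
  have hDc : ⌈Real.exp (π * |c'| + 5)⌉₊ ≤ D :=
    le_trans (le_trans (le_max_left _ _) (le_max_right _ _)) hD
  have hDX : ⌈Real.exp X⌉₊ ≤ D := le_trans (le_trans (le_max_right _ _) (le_max_right _ _)) hD
  obtain ⟨hL5, hα, hcαL⟩ := large_D hDc
  have hLX : X ≤ ell D := by
    have h : Real.exp X ≤ D := le_trans (Nat.le_ceil _) (by exact_mod_cast hDX)
    rw [ell]; exact (Real.le_log_iff_exp_le (lt_of_lt_of_le (Real.exp_pos _) h)).mpr h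
  obtain ⟨H₁', H₂'⟩ := hH D χ hD₀ hq hp
  replace H₁' := H₁' hA j hj
  replace H₂' := H₂' hA j hj 6 (by simp)
  ------------------------------------------------------------------
  -- parameters
  ------------------------------------------------------------------
  have hlog2 : 2 ≤ Real.log D := by have h := hL5; rw [ell] at h; linarith
  have hL1 : (1 : ℝ) ≤ ell D := by linarith
  have hL0 : (0 : ℝ) < ell D := by linarith
  have hαeq : alpha D = π / ell D ^ 9 := by rw [alpha, bigP, Real.log_exp]
  have hαL : alpha D * ell D ^ 9 = π := by rw [hαeq]; field_simp
  obtain ⟨hhiN, hP2lo, hT1, hP1⟩ := range_sizes (D := D) hlog2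
  obtain ⟨h11, -⟩ := bigT_lt_rpow hL5
  have h59 : (1953125 : ℝ) ≤ ell D ^ 9 := by
    have h := pow_le_pow_left₀ (by norm_num : (0:ℝ) ≤ 5) hL5 9
    norm_num at h
    exact h
  have h7L : (78125 : ℝ) * ell D ^ 2 ≤ ell D ^ 9 := by
    have hL7 : (78125 : ℝ) ≤ ell D ^ 7 := by
      have h := pow_le_pow_left₀ (by norm_num : (0:ℝ) ≤ 5) hL5 7
      norm_num at h
      exact h
    calc (78125 : ℝ) * ell D ^ 2 ≤ ell D ^ 7 * ell D ^ 2 := by gcongr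
      _ = ell D ^ 9 := by ring
  have hMT0 := mainTerm_eq c' χ hlog2 j
  have hreidx0 := drSum_reindex c' χ j (Sec10B.mSum11 c' χ j) (Sec10B.nSum13 c' χ j)
    (lo := bigP D ^ (0.5 : ℝ)) hhiN
  set P : ℝ := bigP D with hPdef
  set lo : ℝ := bigP D ^ (0.5 : ℝ) with hlodef
  set hi : ℝ := bigP D ^ (0.502 : ℝ) with hhidef
  set T : ℝ := bigT D with hTdef
  have hlo_exp : lo = Real.exp (0.5 * ell D ^ 9) := bigP_rpow D 0.5
  have hhi_exp : hi = Real.exp (0.502 * ell D ^ 9) := bigP_rpow D 0.502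
  have hP1_exp : P1 D = Real.exp (0.504 * ell D ^ 9) := bigP_rpow D 0.504
  have hlogP : Real.log P = ell D ^ 9 := log_bigP D
  have hT_exp : T = Real.exp (ell D ^ (1.1 : ℝ)) := rfl
  set M : ℕ → ℂ := Sec10B.mSum11 c' χ j with hMdef
  set N : ℕ → ℕ → ℂ := Sec10B.nSum13 c' χ j with hNdef
  set S : Finset ℕ := (Finset.Ico 1 (Nsupp D)).filter (fun n : ℕ => lo ≤ (n : ℝ) ∧ (n : ℝ) < hi)
    with hSdef
  clear_value P lo hi T M N S
  have hP0 : 0 < P := lt_trans zero_lt_one hP1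
  have hlo0 : 0 < lo := by rw [hlo_exp]; exact Real.exp_pos _
  have hT0 : 0 < T := lt_of_lt_of_le zero_lt_one hT1
  have hT1' : 1 < T := by
    rw [hT_exp]; exact Real.one_lt_exp_iff.mpr (Real.rpow_pos_of_pos hL0 _)
  have hP1pos : 0 < P1 D := by rw [hP1_exp]; exact Real.exp_pos _
  have hlogP1 : Real.log (P1 D) = 0.504 * ell D ^ 9 := by rw [hP1_exp, Real.log_exp]
  have hlogP1pos : 0 < Real.log (P1 D) := by rw [hlogP1]; positivity
  have hhiT_exp : hi / T = Real.exp (0.502 * ell D ^ 9 - ell D ^ (1.1 : ℝ)) := by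
    rw [hhi_exp, hT_exp, ← Real.exp_sub]
  -- the objects of the abstract assembly (opaque names with defining equations)
  obtain ⟨a, hadef⟩ : ∃ a : ℕ → ℂ, a = fun n : ℕ => (‖χ (n : ZMod D)‖ : ℂ) * lamZero c' D j n / (n : ℂ) :=
    ⟨_, rfl⟩
  obtain ⟨M₀, hM₀def⟩ : ∃ M₀ : ℕ → ℂ, M₀ = fun n : ℕ => deriv χ.LFunction 1 *
      frakfW c' D j 6 (P1 D / n) / (Real.log (P1 D) : ℂ) := ⟨_, rfl⟩
  obtain ⟨G, hGdef⟩ : ∃ G : ℕ → ℂ, G = fun n : ℕ => -1 + fraky1 c' D j n := ⟨_, rfl⟩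
  obtain ⟨c₀, hc₀def⟩ : ∃ c₀ : ℂ, c₀ = 500 * deriv χ.LFunction 1 / (Real.log P : ℂ) := ⟨_, rfl⟩
  obtain ⟨main, hmaindef⟩ : ∃ main : ℕ → Prop, main = fun n : ℕ => lo < (n : ℝ) ∧ (n : ℝ) ≤ hi / T :=
    ⟨_, rfl⟩
  have hmemS : ∀ {n : ℕ}, n ∈ S → 1 ≤ n ∧ lo ≤ (n : ℝ) ∧ (n : ℝ) < hi := by
    intro n hn
    rw [hSdef, Finset.mem_filter, Finset.mem_Ico] at hn
    exact ⟨hn.1.1, hn.2.1, hn.2.2⟩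
  have hSne : ∀ n ∈ S, n ≠ 0 := fun n hn => by have := (hmemS hn).1; omega
  -- (A) re-indexing
  have hreidx : Sec10B.drSum c' χ j M N lo hi =
      ∑ n ∈ S, ∑ r ∈ n.divisors,
        (if Squarefree r then a n / (Nat.totient r : ℂ) * M n * N (n / r) r else 0) := by
    rw [hadef]; exact hreidx0
  -- (B) hypotheses of the abstract assembly
  have hμ6 : betaMu D 6 = beta6 D := by simp [betaMu]
  have hxfacts : ∀ {n : ℕ}, n ∈ S →
      T < P1 D / n ∧ P1 D / n < P ∧ |Real.log (P1 D / n)| ≤ ell D ^ 9 ∧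
      |Real.log (n / lo)| ≤ 0.004 * ell D ^ 9 ∧ |Real.log (P1 D / n)| ≤ 0.004 * ell D ^ 9 ∧
      |Real.log (hi / n)| ≤ 0.004 * ell D ^ 9 := by
    intro n hn
    obtain ⟨hn1, hlon, hnhi⟩ := hmemS hn
    rw [hlodef] at hlon ⊢
    rw [hhidef] at hnhi ⊢
    rw [hTdef, hPdef]
    exact range_xfacts hL5 hn1 hlon hnhi
  have hLp : ‖deriv χ.LFunction 1‖ ≤ 4 * Real.exp (9 / 2) * ell D ^ 2 :=
    norm_deriv_LFunction_one_le χ (by linarith) hp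
  -- (B1) `M = M₀ + O(eM)` (on all of `S`)
  have hMall : ∀ n ∈ S, ‖M n - M₀ n‖ ≤ |C₂| * (ell D ^ 6)⁻¹ / (0.504 * ell D ^ 9) := by
    intro n hn
    obtain ⟨hn1, hlon, hnhi⟩ := hmemS hn
    obtain ⟨hTx, hxP, -, -, -, -⟩ := hxfacts hn
    have hP2n : P2 D ≤ (n : ℝ) := hP2lo.trans hlon
    have hMn : M n = (1 / (Real.log (P1 D) : ℂ)) * ∑ m ∈ Finset.Ico 1 ⌈P1 D / n⌉₊,
        χ (m : ZMod D) / (m : ℂ) ^ (1 - betaJ c' D j) *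
          (((P1 D / n) / m : ℝ) : ℂ) ^ beta6 D * (Real.log ((P1 D / n) / m) : ℂ) := by
      rw [hMdef]; exact mSum11_eq c' χ hlog2 j hn1 hP2n
    have h82 := H₂' (P1 D / n) hTx hxP
    rw [hμ6] at h82
    have hdiff : M n - M₀ n = (1 / (Real.log (P1 D) : ℂ)) *
        ((∑ m ∈ Finset.Ico 1 ⌈P1 D / n⌉₊, χ (m : ZMod D) / (m : ℂ) ^ (1 - betaJ c' D j) *
          (((P1 D / n) / m : ℝ) : ℂ) ^ beta6 D * (Real.log ((P1 D / n) / m) : ℂ)) -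
          deriv χ.LFunction 1 * frakfW c' D j 6 (P1 D / n)) := by
      rw [hMn, hM₀def]
      have : (Real.log (P1 D) : ℂ) ≠ 0 := by exact_mod_cast hlogP1pos.ne'
      field_simp
    rw [hdiff, norm_mul, norm_div, norm_one, Complex.norm_real, Real.norm_of_nonneg hlogP1pos.le,
      hlogP1]
    have h82' := h82.trans (mul_le_mul_of_nonneg_right (le_abs_self C₂) (by positivity))
    calc 1 / (0.504 * ell D ^ 9) * _ ≤ 1 / (0.504 * ell D ^ 9) * (|C₂| * (ell D ^ 6)⁻¹) := by
          gcongr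
      _ = |C₂| * (ell D ^ 6)⁻¹ / (0.504 * ell D ^ 9) := by ring
  have hM : ∀ n ∈ S, main n → ‖M n - M₀ n‖ ≤ |C₂| * (ell D ^ 6)⁻¹ / (0.504 * ell D ^ 9) :=
    fun n hn _ => hMall n hn
  -- (B2) `|M₀| ≤ BM`
  have hM₀ : ∀ n ∈ S, ‖M₀ n‖ ≤ 4 * Real.exp (9 / 2) * ell D ^ 2 * 32 / (0.504 * ell D ^ 9) := by
    intro n hn
    obtain ⟨-, -, hlx, -, -, -⟩ := hxfacts hn
    have hf := norm_frakfW_six_le hcαL hα hαL hL0.le j hlx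
    rw [hM₀def]
    simp only
    rw [norm_div, norm_mul, Complex.norm_real, Real.norm_of_nonneg hlogP1pos.le, hlogP1]
    gcongr
  -- (B2') `|M| ≤ BM + eM` on the windows
  have hMW : ∀ n ∈ S, ¬ main n → ‖M n‖ ≤
      4 * Real.exp (9 / 2) * ell D ^ 2 * 32 / (0.504 * ell D ^ 9) +
        |C₂| * (ell D ^ 6)⁻¹ / (0.504 * ell D ^ 9) := by
    intro n hn _
    have h1 := hMall n hn
    have h2 := hM₀ n hn
    have h3 : ‖M n‖ ≤ ‖M₀ n‖ + ‖M n - M₀ n‖ := norm_le_norm_add_norm_sub' (M n) (M₀ n)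
    linarith
  -- (B3) `|G| ≤ 2`
  have hG : ∀ n ∈ S, ‖G n‖ ≤ 2 := by
    intro n hn
    obtain ⟨-, -, -, h1, h2, h3⟩ := hxfacts hn
    rw [hlodef] at h1
    rw [hhidef] at h3
    rw [hGdef]
    exact norm_fraky1_sub_le hcαL hα hαL hL0.le j h1 h2 h3
  -- (B4) main `n`: Lemma 10.2 (10.9), relative
  have hN : ∀ n ∈ S, main n → ∀ r ∈ n.divisors, Squarefree r →
      ‖N (n / r) r - c₀ * PiW χ (n / r) r * G n‖ ≤
        |C₁| * (ell D ^ 15)⁻¹ * ((n : ℝ) / Nat.totient n) ^ 2 := by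
    intro n hn hmain r hr _
    obtain ⟨hn1, -, -⟩ := hmemS hn
    have hr0 : 0 < r := Nat.pos_of_mem_divisors hr
    have hrn : r ∣ n := (Nat.mem_divisors.mp hr).1
    have hnr : n / r * r = n := Nat.div_mul_cancel hrn
    have hd1 : 1 ≤ n / r := Nat.div_pos (Nat.le_of_dvd (by omega) hrn) hr0
    have hcast : ((n / r * r : ℕ) : ℝ) = n := by rw [hnr]
    have hNeq : N (n / r) r = frakv2 c' χ j (n / r) r := by
      rw [hNdef]; exact nSum13_eq_frakv2 c' χ hlog2 j hd1 hr0
    have hmain' : lo < (n : ℝ) ∧ (n : ℝ) ≤ hi / T := by rw [hmaindef] at hmain; exact hmain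
    have h := (H₁' (n / r) r hd1 hr0).1 (by rw [hcast]; exact hmain'.1)
      (by rw [hcast]; exact hmain'.2)
    rw [hcast, hnr, prod_one_sub_inv_inv_sq_eq (hSne n hn)] at h
    rw [hNeq, hGdef, hc₀def]
    simp only
    refine le_trans (le_of_eq ?_) (h.trans ?_)
    · congr 1
      ring
    · gcongr; exact le_abs_self _
  -- (B5) window `n`: Lemma 10.2 (10.11), weighted
  have hW : ∀ n ∈ S, ¬ main n → ∀ r ∈ n.divisors, Squarefree r →
      ‖N (n / r) r‖ ≤ |C₁| * (ell D ^ 7)⁻¹ * ((n : ℝ) / Nat.totient n) ^ 2 := by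
    intro n hn hmain r hr _
    obtain ⟨hn1, hlon, hnhi⟩ := hmemS hn
    have hr0 : 0 < r := Nat.pos_of_mem_divisors hr
    have hrn : r ∣ n := (Nat.mem_divisors.mp hr).1
    have hnr : n / r * r = n := Nat.div_mul_cancel hrn
    have hd1 : 1 ≤ n / r := Nat.div_pos (Nat.le_of_dvd (by omega) hrn) hr0
    have hcast : ((n / r * r : ℕ) : ℝ) = n := by rw [hnr]
    have hNeq : N (n / r) r = frakv2 c' χ j (n / r) r := by
      rw [hNdef]; exact nSum13_eq_frakv2 c' χ hlog2 j hd1 hr0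
    have hwin : (lo / T < ((n / r * r : ℕ) : ℝ) ∧ ((n / r * r : ℕ) : ℝ) ≤ lo) ∨
        (hi / T < ((n / r * r : ℕ) : ℝ) ∧ ((n / r * r : ℕ) : ℝ) ≤ hi) ∨
        (P ^ (0.504 : ℝ) / T < ((n / r * r : ℕ) : ℝ) ∧
          ((n / r * r : ℕ) : ℝ) < P ^ (0.504 : ℝ)) := by
      rw [hcast]
      rw [hmaindef] at hmain
      simp only [not_and_or, not_lt, not_le] at hmain
      rcases hmain with h | h
      · left
        refine ⟨?_, h⟩
        calc lo / T < lo := div_lt_self hlo0 hT1'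
          _ ≤ n := hlon
      · right; left
        exact ⟨h, hnhi.le⟩
    have h := (H₁' (n / r) r hd1 hr0).2 hwin
    rw [hnr, prod_one_sub_inv_inv_sq_eq (hSne n hn)] at h
    rw [hNeq]
    refine h.trans ?_
    gcongr; exact le_abs_self _
  -- (B6) the (8.10) collapse
  have hPi : ∀ n ∈ S, main n →
      ∑ r ∈ n.divisors with Squarefree r, (1 / (Nat.totient r : ℂ)) * PiW χ (n / r) r =
        (n : ℂ) / (Nat.totient n : ℂ) := fun n hn _ => h810 D χ hq n (hSne n hn)
  ------------------------------------------------------------------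
  -- (C) the abstract assembly (doubly weighted)
  ------------------------------------------------------------------
  have heM0 : 0 ≤ |C₂| * (ell D ^ 6)⁻¹ / (0.504 * ell D ^ 9) := by positivity
  have hBM0 : 0 ≤ 4 * Real.exp (9 / 2) * ell D ^ 2 * 32 / (0.504 * ell D ^ 9) := by positivity
  have hBW0 : 0 ≤ 4 * Real.exp (9 / 2) * ell D ^ 2 * 32 / (0.504 * ell D ^ 9) +
      |C₂| * (ell D ^ 6)⁻¹ / (0.504 * ell D ^ 9) := by positivity
  have hRA := range_assembly_bound₃ hSne main a M M₀ G N (PiW χ) c₀ heM0 hBM0 hBW0 hPi hM hM₀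
    hMW hG hN hW
  ------------------------------------------------------------------
  -- (D) main term, weights, constants
  ------------------------------------------------------------------
  have hMT : 500 * deriv χ.LFunction 1 ^ 2 / (0.504 * Sec10B.logP D ^ 2) *
        Sec10B.nAvg c' χ j lo hi
          (fun n => frakfW c' D j 6 (P ^ (0.504 : ℝ) / n) * (-1 + fraky1 c' D j n)) =
      ∑ n ∈ S, a n * ((n : ℂ) / (Nat.totient n : ℂ)) * (M₀ n * c₀ * G n) := by
    rw [hadef, hM₀def, hGdef, hc₀def]
    exact hMT0
  have hweight : ∀ n ∈ S, ∀ k : ℕ, ‖a n‖ * ((n : ℝ) / Nat.totient n) ^ k ≤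
      ((n : ℝ) / Nat.totient n) ^ (k + 4) / n := by
    intro n hn k
    rw [hadef]
    exact norm_weight_pow_le c' χ j (hSne n hn) k
  have hWmain_le : ∑ n ∈ S.filter main, ‖a n‖ * ((n : ℝ) / Nat.totient n) ^ 3 ≤
      Real.exp 256 * ell D ^ 9 := by
    have hfull := weight_sum_exp_range 7 (A := 0.5 * ell D ^ 9) (B := 0.502 * ell D ^ 9)
      (by linarith [h59]) (by linarith [h59]) S (fun n hn => by
        obtain ⟨h1, h2, h3⟩ := hmemS hn
        rw [hlo_exp] at h2; rw [hhi_exp] at h3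
        exact ⟨h1, h2, h3⟩)
    have h256 : Real.exp (2 ^ (7 + 1)) = Real.exp 256 := by norm_num
    rw [h256] at hfull
    calc ∑ n ∈ S.filter main, ‖a n‖ * ((n : ℝ) / Nat.totient n) ^ 3
        ≤ ∑ n ∈ S.filter main, ((n : ℝ) / Nat.totient n) ^ 7 / n :=
          Finset.sum_le_sum fun n hn => hweight n (Finset.mem_of_mem_filter n hn) 3
      _ ≤ ∑ n ∈ S, ((n : ℝ) / Nat.totient n) ^ 7 / n :=
          Finset.sum_le_sum_of_subset_of_nonneg (Finset.filter_subset _ _) fun n _ _ => by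
            positivity
      _ ≤ Real.exp 256 * (2 + (0.502 * ell D ^ 9 - 0.5 * ell D ^ 9)) := hfull
      _ ≤ Real.exp 256 * ell D ^ 9 := by gcongr; linarith [h59]
  have hWwin_le : ∑ n ∈ S.filter (fun n => ¬ main n), ‖a n‖ * ((n : ℝ) / Nat.totient n) ^ 3 ≤
      2 * Real.exp 256 * ell D ^ 2 := by
    have hwin := weight_sum_windows 7 (A := 0.5 * ell D ^ 9) (B := 0.502 * ell D ^ 9)
      (τ := ell D ^ (1.1 : ℝ)) (by linarith [h59]) (by positivity)
      (by have h2pos : 0 < ell D ^ 2 := pow_pos hL0 2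
          linarith [h11, h7L])
      (S.filter (fun n => ¬ main n)) (fun n hn => by
        rw [Finset.mem_filter] at hn
        obtain ⟨hnS, hnm⟩ := hn
        obtain ⟨h1, h2, h3⟩ := hmemS hnS
        rw [hmaindef] at hnm
        simp only [not_and_or, not_lt, not_le] at hnm
        refine ⟨h1, ?_⟩
        rcases hnm with h | h
        · left; rw [← hlo_exp]; exact ⟨h2, h⟩
        · right
          rw [← hhiT_exp, ← hhi_exp]
          exact ⟨h.le, h3⟩)
    have h256 : Real.exp (2 ^ (7 + 1)) = Real.exp 256 := by norm_num
    rw [h256] at hwin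
    calc ∑ n ∈ S.filter (fun n => ¬ main n), ‖a n‖ * ((n : ℝ) / Nat.totient n) ^ 3
        ≤ ∑ n ∈ S.filter (fun n => ¬ main n), ((n : ℝ) / Nat.totient n) ^ 7 / n :=
          Finset.sum_le_sum fun n hn => hweight n (Finset.mem_of_mem_filter n hn) 3
      _ ≤ Real.exp 256 * (5 + ell D ^ (1.1 : ℝ)) := hwin
      _ ≤ Real.exp 256 * (2 * ell D ^ 2) := by
          gcongr
          have h25 : (25 : ℝ) ≤ ell D ^ 2 := by
            have h := pow_le_pow_left₀ (by norm_num : (0:ℝ) ≤ 5) hL5 2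
            norm_num at h
            exact h
          linarith [h11]
      _ = 2 * Real.exp 256 * ell D ^ 2 := by ring
  have hc₀' : ‖c₀‖ ≤ 2000 * Real.exp (9 / 2) * (ell D ^ 7)⁻¹ := by
    rw [hc₀def, norm_div, norm_mul, Complex.norm_real, Real.norm_of_nonneg (by rw [hlogP]; positivity),
      hlogP]
    have h500 : ‖(500 : ℂ)‖ = 500 := by norm_num
    rw [h500, div_eq_mul_inv]
    have : (2000 : ℝ) * Real.exp (9 / 2) * (ell D ^ 7)⁻¹ =
        500 * (4 * Real.exp (9 / 2) * ell D ^ 2) * (ell D ^ 9)⁻¹ := by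
      field_simp; ring
    rw [this]
    gcongr
  obtain ⟨hKmain, hKwin⟩ := consts_bound (C₁ := C₁) (C₂ := C₂) hL5 (norm_nonneg c₀) hc₀'
  have hKwin' : (4 * Real.exp (9 / 2) * ell D ^ 2 * 32 / (0.504 * ell D ^ 9) +
        |C₂| * (ell D ^ 6)⁻¹ / (0.504 * ell D ^ 9)) * (|C₁| * (ell D ^ 7)⁻¹) +
      4 * Real.exp (9 / 2) * ell D ^ 2 * 32 / (0.504 * ell D ^ 9) * ‖c₀‖ * 2 ≤
      K₂ * (ell D ^ 12)⁻¹ := by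
    refine hKwin.trans ?_
    have h1412 : (ell D ^ 14)⁻¹ ≤ (ell D ^ 12)⁻¹ := by
      rw [inv_le_inv₀ (by positivity) (by positivity)]
      exact pow_le_pow_right₀ hL1 (by norm_num)
    exact mul_le_mul_of_nonneg_left h1412 hK₂0
  ------------------------------------------------------------------
  -- (E) conclusion
  ------------------------------------------------------------------
  rw [hreidx, hMT]
  refine hRA.trans ?_
  rw [hαeq]
  exact final_bound_rel hL1 hε hK₁0 hK₂0 (by positivity) (by positivity)
    hWmain_le hWwin_le hKmain hKwin' (by rw [hX] at hLX; linarith)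

end Literature.NumberTheory.LFunctions.Zhang2022.Skeleton
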